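import Mathlib
import Summits.Ventures.HodgeRepro2.T6N5LocalSignModelGlobal

/-!
# T6N5LocalSignModelCM — Tier 6, M2 sub-step N5 (t6-p8's half): THE HOST-SHAPED SIGN-MODEL STATEMENT ON A CM FIELD
— the quadratic datum `hKL` of `T6N5LocalSignModelGlobal` supplied by Mathlib from `NumberField.IsCMField`

`exists_signModel_ofGlobal` (T6N5LocalSignModelGlobal) binds `hKL : Module.finrank K L = 2` for a quadratic extension
`K ⊆ L` of number fields. On the host's CM field `E` (`[NumberField.IsCMField E]`, the instance the host statement
carries) the route's `K⁺ ⊆ K` is `maximalRealSubfield E ⊆ E`, and: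
* `finrank_maximalRealSubfield_eq_two` — `hKL` is Mathlib's `Algebra.IsQuadraticExtension.finrank_eq_two` on the
  class field `IsCMField.is_quadratic` (0 new lemmas);
* `isTotallyReal_maximalRealSubfield'` — `E⁺` is totally real (Mathlib's `isTotallyReal_maximalRealSubfield`), so the
  real places in `GlobalIndex E⁺` are ALL the infinite places of `E⁺` (TIER5 §N5.5's reading);
* `PlaceFamily.ofCM` / `exists_signModel_ofCM` — the place family and the host-shaped statement with `hKL` discharged:
  three data at every non-split finite place of `E⁺` with the per-place `Hyps`, real data on both sides at every real
  place of `E⁺` with t6-p7's three hypotheses ⇒ a sign model on `GlobalIndex E⁺` with `Solves ∧ RealCondB`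
  (ledger rows 183–184). The instances `NumberField ↥(maximalRealSubfield E)`, `Algebra (maximalRealSubfield E) E`
  are Mathlib's (`Subfield`).

WHAT THE HOST STILL SUPPLIES after this file (rows 183–184): the `ThreeDataFamily (maximalRealSubfield E) E` with its
`Hyps`, and t6-p7's `RealData` per real place and side with its three hypotheses; `hKL`, the index type, the kinds
and the place data are theorems. Definition lane; no display. Filed in WAVE 1 (p437993, 2026-08-26).
§8(d): uses an L-value-free non-vanishing device: NO.
-/

namespace Summit.Ventures.HodgeRepro2.T6.N5LocalSignModelCM

open Summit.Ventures.HodgeRepro2 IsDedekindDomain HeightOneSpectrum NumberField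
  Summit.Ventures.HodgeRepro2.T6.N5Rich Summit.Ventures.HodgeRepro2.T6.N5RealPlace
  Summit.Ventures.HodgeRepro2.T6.N5LocalSignModel Summit.Ventures.HodgeRepro2.T6.N5LocalSignModelGlobal

noncomputable section

section CM

variable (E : Type) [Field E] [NumberField E]

/-- `hKL` on the host's CM field: `[E : E⁺] = 2` with `E⁺ = maximalRealSubfield E` — Mathlib's
`Algebra.IsQuadraticExtension.finrank_eq_two` on the class field `IsCMField.is_quadratic`. -/
theorem finrank_maximalRealSubfield_eq_two [IsCMField E] :
    Module.finrank (maximalRealSubfield E) E = 2 :=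
  Algebra.IsQuadraticExtension.finrank_eq_two _ _

/-- `E⁺` is totally real (Mathlib): every infinite place of `E⁺` is real, so `GlobalIndex E⁺` indexes ALL the places
of `E⁺`. -/
theorem isTotallyReal_maximalRealSubfield' : IsTotallyReal (maximalRealSubfield E) :=
  isTotallyReal_maximalRealSubfield

/-- Every infinite place of `E⁺` is real. -/
theorem isReal_infinitePlace_maximalRealSubfield (τ : InfinitePlace (maximalRealSubfield E)) : τ.IsReal :=
  (isTotallyReal_maximalRealSubfield' E).isReal τ

variable [IsCMField E]

/-- THE PLACE FAMILY OF THE HOST'S CM FIELD over its maximal totally real subfield, from three data at every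
non-split finite place of `E⁺`: `PlaceFamily.ofGlobal` with `hKL` from `IsCMField`. -/
def PlaceFamily.ofCM (T : ThreeDataFamily (maximalRealSubfield E) E) :
    PlaceFamily (maximalRealSubfield E) E (GlobalIndex (maximalRealSubfield E)) :=
  PlaceFamily.ofGlobal (finrank_maximalRealSubfield_eq_two E) T

/-- THE HOST-SHAPED STATEMENT ON A CM FIELD (ledger rows 183–184 `hsol` / `hre`): three data at every non-split
finite place of `E⁺` satisfying the per-place hypotheses of the statements of record v2, and real data on both sides
at every real place of `E⁺` with t6-p7's three hypotheses, give a sign model on `GlobalIndex E⁺` with the kinds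
`kindOf E⁺ E`, the local data of `PlaceFamily.ofCM`, `Solves` and `RealCondB`. -/
theorem exists_signModel_ofCM (T : ThreeDataFamily (maximalRealSubfield E) E)
    (hT : ∀ (v : HeightOneSpectrum (RingOfIntegers (maximalRealSubfield E)))
      (h : IsNonSplit (maximalRealSubfield E) E v),
      (localInputAt (finrank_maximalRealSubfield_eq_two E) T h).Hyps)
    (RA RB : GlobalIndex (maximalRealSubfield E) → RealData)
    (h35A : ∀ τ : {τ : InfinitePlace (maximalRealSubfield E) // τ.IsReal},
      Hyp.BFGYYZ2025_Thm3_5 (RA (Sum.inr τ)).toLocal)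
    (h35B : ∀ τ : {τ : InfinitePlace (maximalRealSubfield E) // τ.IsReal},
      Hyp.BFGYYZ2025_Thm3_5 (RB (Sum.inr τ)).toLocal)
    (hFA : ∀ τ : {τ : InfinitePlace (maximalRealSubfield E) // τ.IsReal}, (RA (Sum.inr τ)).FockDict)
    (hFB : ∀ τ : {τ : InfinitePlace (maximalRealSubfield E) // τ.IsReal}, (RB (Sum.inr τ)).FockDict)
    (hHA : ∀ τ : {τ : InfinitePlace (maximalRealSubfield E) // τ.IsReal}, ∀ i, (RA (Sum.inr τ)).HalfLine i)
    (hHB : ∀ τ : {τ : InfinitePlace (maximalRealSubfield E) // τ.IsReal}, ∀ i, (RB (Sum.inr τ)).HalfLine i) :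
    ∃ S : SignModel (GlobalIndex (maximalRealSubfield E)),
      S.kind = kindOf (maximalRealSubfield E) E ∧ S.D = (PlaceFamily.ofCM E T).D ∧ S.Solves ∧ S.RealCondB :=
  exists_signModel_ofGlobal (finrank_maximalRealSubfield_eq_two E) T hT RA RB h35A h35B hFA hFB hHA hHB

end CM

end

end Summit.Ventures.HodgeRepro2.T6.N5LocalSignModelCM
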